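import Mathlib
import Summits.ValiantsHypothesis.ValiantsHypothesis.Theorems.NewtonUnitEquationsTwoProductsFormalLogLinearisationLogSumEngineOne
import Summits.ValiantsHypothesis.ValiantsHypothesis.Theorems.TwoProducts.Negative.CommonPadding
import Summits.ValiantsHypothesis.ValiantsHypothesis.Theorems.TwoProducts.Negative.FullPadding
import HarnessLib

/-!
# NEGATIVE lane (val-neg-1 g5): ONE-SIDED deep padding (gadgets on one side, trivial factors on the other)

Helper file for crux `stmt-ValiantsHypothesis-5906` (filed `--supports`; closes NO item, proves NO summit statement, does NOT prove
`TwoProducts`, `PlanarCellBound`, any `ResidualLawV…` or VP ≠ VNP; 0 `def`s).  Sequel to `Negative/FullPadding.lean` (same seat).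

The two-sided padding of `FullPadding.lean` appends the SAME gadget factors to both products; it is undone by the (untyped) normalisation
«cancel common factors».  Here the `2g` gadget factors `1 + X^{c_i σ} + X^{2 c_i σ}` (`c_i = 2·5^i`, `σ = N s`, `s` = tail-letter sum) are appended to
the `u`-side ONLY, and `2g` TRIVIAL factors `1 + 0` to the `v`-side (the typed way of writing products of unequal length).  The letter family
`supp u_j ∪ supp v_j` is the same as for the two-sided padding, so `FullPaddingThresholds.lean` applies verbatim; what changes is the log-sum:
`D' = D + 2 Σ_i log(1 + z_i)`, whose new support points lie on the ray `ℕσ`.  `oneSided_spec`: for `N` larger than the `ℓ¹`-norm of every point of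
the cell family `S`, no point of `S` is on that ray, the new points lie below every point of `S` for every valid weight
(`norm_mul_wt_le_of_mem_logSupport`: a log-support point `l` has `wt ξ l ≥ |l|₁ · wt ξ s`), and `S` stays a cell family of the padded pair
(`isCellFamily_append_oneSided`).  Consequence in `OneSidedPaddingResidual.lean`: the equivalence «residual ⇔ PlanarCellBound» survives every side
condition that is stable under this one-sided padding (no common factor, no equal non-trivial sub-products, …).  [folklore]
-/

namespace Summit.ValiantsHypothesis.Theorems.TwoProducts.Negative.OneSidedPadding

open Finset MvPolynomial
open Summit.ValiantsHypothesis.ValiantsHypothesis.Theorems.NewtonUnitEquations.TwoProducts.FormalLogLinearisation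
open Summit.ValiantsHypothesis.ValiantsHypothesis.Theorems.NewtonUnitEquations.TwoProducts.PlanarCell
open Summit.ValiantsHypothesis.Theorems.TwoProducts.Negative.CommonPadding
open Summit.ValiantsHypothesis.Theorems.TwoProducts.Negative.FullPadding (scale_ne_zero two_le_scale)

variable {m k g : ℕ}

/-! ### Cells survive one-sided appending, given control of the log-support on `S` -/

/-- **Cell families survive appending `w ∣ w'`**, provided the valid weights of the old family are negative on the new tails, the new tail
letters lie strictly below the old ones and are ordered among themselves by a fixed `Q`, and every point of `S` that is a strict top of the old
log-support is a strict top of the new one. [folklore] -/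
theorem isCellFamily_append_oneSided (u v : Fin m → MvPolynomial (Fin 2) ℂ) (w w' : Fin k → MvPolynomial (Fin 2) ℂ)
    (Q : Expo → Expo → Prop) (S : Finset Expo)
    (hneg : ∀ ξ, ValidWeight u v ξ → ValidWeight w w' ξ)
    (hdeep : ∀ ξ, ValidWeight u v ξ → ∀ e ∈ tailSupport u v, ∀ e' ∈ tailSupport w w', wt ξ e' < wt ξ e)
    (hQ : ∀ ξ, ValidWeight u v ξ → ∀ e ∈ tailSupport w w', ∀ e' ∈ tailSupport w w', (Q e e' ↔ wt ξ e ≤ wt ξ e'))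
    (hlog : ∀ ξ, ValidWeight u v ξ → ∀ l ∈ S, IsStrictTop ξ (logSupport u v) l →
      IsStrictTop ξ (logSupport (Fin.append u w) (Fin.append v w')) l)
    (R : Expo → Expo → Prop) (hS : IsCellFamily u v R S) :
    IsCellFamily (Fin.append u w) (Fin.append v w')
      (fun e e' => (e ∈ tailSupport u v → e' ∈ tailSupport u v ∧ R e e') ∧
        (e ∉ tailSupport u v → e' ∈ tailSupport u v ∨ Q e e')) S := by
  intro l hl
  obtain ⟨ξ, hval, htop, hR⟩ := hS l hl
  refine ⟨ξ, (validWeight_append_iff u v w w' ξ).2 ⟨hval, hneg ξ hval⟩, hlog ξ hval l hl htop, ?_⟩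
  intro e he e' he'
  rw [tailSupport_append, Finset.mem_union] at he he'
  by_cases heT : e ∈ tailSupport u v
  · by_cases heT' : e' ∈ tailSupport u v
    · simp only [heT, heT', true_and, forall_true_left, not_true_eq_false, IsEmpty.forall_iff, and_true]
      exact hR e heT e' heT'
    · have he'N : e' ∈ tailSupport w w' := he'.resolve_left heT'
      have hlt := hdeep ξ hval e heT e' he'N
      simp only [heT, heT', false_and, forall_true_left, not_true_eq_false, IsEmpty.forall_iff, and_true,
        false_iff, not_le]
      exact hlt
  · have heN : e ∈ tailSupport w w' := he.resolve_left heT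
    by_cases heT' : e' ∈ tailSupport u v
    · have hlt := hdeep ξ hval e' heT' e heN
      simp only [heT, heT', IsEmpty.forall_iff, not_false_eq_true, true_or, forall_true_left, and_self,
        true_iff]
      exact hlt.le
    · have he'N : e' ∈ tailSupport w w' := he'.resolve_left heT'
      simp only [heT, heT', IsEmpty.forall_iff, not_false_eq_true, false_or, forall_true_left, true_and]
      exact hQ ξ hval e heN e' he'N

/-! ### Log-coefficients of polynomials supported on a ray -/

/-- Powers of a polynomial supported on the ray `ℕσ` are supported on the ray. [folklore] -/
theorem mem_ray_of_mem_support_pow (p : MvPolynomial (Fin 2) ℂ) (σ : Expo) (hp : ∀ e ∈ p.support, ∃ n : ℕ, e = n • σ) :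
    ∀ (r : ℕ), ∀ e ∈ (p ^ r).support, ∃ n : ℕ, e = n • σ := by
  classical
  intro r
  induction r with
  | zero =>
    intro e he
    rw [pow_zero] at he
    have h1 : (1 : MvPolynomial (Fin 2) ℂ) = monomial 0 1 := rfl
    rw [h1, support_monomial, if_neg one_ne_zero, Finset.mem_singleton] at he
    exact ⟨0, by rw [he, zero_nsmul]⟩
  | succ r ih =>
    intro e he
    rw [pow_succ] at he
    obtain ⟨a, ha, c, hc, rfl⟩ := Finset.mem_add.1 (support_mul _ _ he)
    obtain ⟨n, rfl⟩ := ih a ha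
    obtain ⟨n', rfl⟩ := hp c hc
    exact ⟨n + n', by rw [add_nsmul]⟩

/-- The log-coefficients of a polynomial supported on the ray `ℕσ` vanish off the ray. [folklore] -/
theorem logCoeff_eq_zero_off_ray (p : MvPolynomial (Fin 2) ℂ) (σ : Expo) (hp : ∀ e ∈ p.support, ∃ n : ℕ, e = n • σ)
    (l : Expo) (hl : ∀ n : ℕ, l ≠ n • σ) : logCoeff p l = 0 := by
  classical
  unfold logCoeff
  refine Finset.sum_eq_zero fun r _ => ?_
  have : coeff l (p ^ r) = 0 := by
    rw [← MvPolynomial.notMem_support_iff]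
    intro h
    obtain ⟨n, hn⟩ := mem_ray_of_mem_support_pow p σ hp r l h
    exact hl n hn
  rw [this, mul_zero]

/-- The log-coefficient at `0` vanishes (the sum over `r ∈ [1, |0|₁]` is empty). [folklore] -/
theorem logCoeff_at_zero (p : MvPolynomial (Fin 2) ℂ) : logCoeff p 0 = 0 := by
  unfold logCoeff
  simp

/-- Hence `0` is never in the log-support. [folklore] -/
theorem zero_notMem_logSupport (u v : Fin m → MvPolynomial (Fin 2) ℂ) : (0 : Expo) ∉ logSupport u v := by
  intro h
  apply h
  unfold logDiff
  simp [logCoeff_at_zero]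

/-- **One-sided appending and the log-sum**: `D(u ∣ w, v ∣ 0) = D(u, v) + Σ_x log(1 + w_x)` coefficientwise. [folklore] -/
theorem logDiff_append_oneSided (u v : Fin m → MvPolynomial (Fin 2) ℂ) (w : Fin k → MvPolynomial (Fin 2) ℂ) (l : Expo) :
    logDiff (Fin.append u w) (Fin.append v (fun _ : Fin k => (0 : MvPolynomial (Fin 2) ℂ))) l =
      logDiff u v l + ∑ x, logCoeff (w x) l := by
  unfold logDiff
  rw [Fin.sum_univ_add, Fin.sum_univ_add]
  simp only [Fin.append_left, Fin.append_right, logCoeff_zero_poly, Finset.sum_const_zero, add_zero]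
  ring

/-! ### Log-support points are not too low: `wt ξ l ≥ |l|₁ · wt ξ s` -/

/-- The weight is odd in `ξ`. [folklore] -/
theorem wt_neg_weight (ξ : Fin 2 → ℝ) (e : Expo) : wt (-ξ) e = - wt ξ e := by
  simp only [wt, Pi.neg_apply]
  ring

/-- **A point of the log-support lies weakly above `|l|₁ · s`** for every valid weight (`s` = the sum of the tail letters): it is a sum of
`r ≤ |l|₁` tail letters, each weakly above `s`. [folklore] -/
theorem norm_mul_wt_le_of_mem_logSupport {u v : Fin m → MvPolynomial (Fin 2) ℂ} {ξ : Fin 2 → ℝ} (hval : ValidWeight u v ξ)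
    {l : Expo} (hl : l ∈ logSupport u v) :
    ((l 0 + l 1 : ℕ) : ℝ) * wt ξ (∑ f ∈ tailSupport u v, f) ≤ wt ξ l := by
  classical
  have hs : wt ξ (∑ f ∈ tailSupport u v, f) ≤ 0 := by
    rcases (tailSupport u v).eq_empty_or_nonempty with hT | hT
    · rw [hT, Finset.sum_empty, wt_zero]
    · exact (wt_tailSum_neg hval hT).le
  have key : ∀ p : MvPolynomial (Fin 2) ℂ, (∀ a ∈ p.support, a ∈ tailSupport u v) → logCoeff p l ≠ 0 →
      ((l 0 + l 1 : ℕ) : ℝ) * wt ξ (∑ f ∈ tailSupport u v, f) ≤ wt ξ l := by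
    intro p hpT hne
    unfold logCoeff at hne
    obtain ⟨r, hr, hne⟩ := Finset.exists_ne_zero_of_sum_ne_zero hne
    obtain ⟨-, hr2⟩ := Finset.mem_Icc.1 hr
    have hmem : l ∈ (p ^ r).support := MvPolynomial.mem_support_iff.2 (right_ne_zero_of_mul hne)
    have hM : ∀ a ∈ p.support, wt (-ξ) a ≤ - wt ξ (∑ f ∈ tailSupport u v, f) := by
      intro a ha
      rw [wt_neg_weight]
      exact neg_le_neg (wt_tailSum_le hval (hpT a ha))
    have h1 := wt_le_of_mem_support_pow (-ξ) p _ hM r l hmem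
    rw [wt_neg_weight] at h1
    have hr2' : (r : ℝ) ≤ ((l 0 + l 1 : ℕ) : ℝ) := by exact_mod_cast hr2
    nlinarith
  have hD : logDiff u v l ≠ 0 := hl
  unfold logDiff at hD
  by_cases hu : ∑ j, logCoeff (u j) l = 0
  · have hv : ∑ j, logCoeff (v j) l ≠ 0 := fun h => hD (by rw [hu, h, sub_zero])
    obtain ⟨j, -, hj⟩ := Finset.exists_ne_zero_of_sum_ne_zero hv
    refine key (v j) (fun a ha => ?_) hj
    unfold tailSupport
    exact Finset.mem_union_right _ (Finset.mem_biUnion.2 ⟨j, Finset.mem_univ _, ha⟩)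
  · obtain ⟨j, -, hj⟩ := Finset.exists_ne_zero_of_sum_ne_zero hu
    refine key (u j) (fun a ha => ?_) hj
    unfold tailSupport
    exact Finset.mem_union_left _ (Finset.mem_biUnion.2 ⟨j, Finset.mem_univ _, ha⟩)

/-! ### The one-sided padded instance -/

/-- **ONE-SIDED DEEP PADDING.**  `u ∣ (z, z)` against `v ∣ (0, …, 0)`, `z_i = X^{c_i σ} + X^{2c_i σ}`, `σ = N s`: normalised and `t`-sparse
(`t ≥ 2`); same valid weights; new tail letters are `n • s`, `n ≥ 2`; and every cell family `S` of `(u, v)` whose points have `ℓ¹`-norm `< N`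
is a cell family of the padded pair. [folklore] -/
theorem oneSided_spec {t : ℕ} (ht : 2 ≤ t) (u v : Fin m → MvPolynomial (Fin 2) ℂ)
    (hu : ∀ j, coeff 0 (u j) = 0 ∧ (u j).support.card ≤ t) (hv : ∀ j, coeff 0 (v j) = 0 ∧ (v j).support.card ≤ t)
    (hT : (tailSupport u v).Nonempty) (N : ℕ) (hN : 1 ≤ N) (z : Fin g → MvPolynomial (Fin 2) ℂ)
    (hz : z = fun i : Fin g => monomial ((2 * 5 ^ (i : ℕ)) • (N • ∑ f ∈ tailSupport u v, f)) (1 : ℂ) +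
      monomial ((2 * (2 * 5 ^ (i : ℕ))) • (N • ∑ f ∈ tailSupport u v, f)) 1) :
    (∀ j, coeff 0 (Fin.append u (Fin.append z z) j) = 0 ∧ (Fin.append u (Fin.append z z) j).support.card ≤ t) ∧
    (∀ j, coeff 0 (Fin.append v (fun _ : Fin (g + g) => (0 : MvPolynomial (Fin 2) ℂ)) j) = 0 ∧
      (Fin.append v (fun _ : Fin (g + g) => (0 : MvPolynomial (Fin 2) ℂ)) j).support.card ≤ t) ∧
    (∀ ξ, ValidWeight (Fin.append u (Fin.append z z)) (Fin.append v (fun _ : Fin (g + g) => (0 : MvPolynomial (Fin 2) ℂ))) ξ ↔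
      ValidWeight u v ξ) ∧
    (∀ e ∈ tailSupport (Fin.append u (Fin.append z z)) (Fin.append v (fun _ : Fin (g + g) => (0 : MvPolynomial (Fin 2) ℂ))),
      e ∈ tailSupport u v ∨ ∃ n, 2 ≤ n ∧ e = n • ∑ f ∈ tailSupport u v, f) ∧
    (∀ (R : Expo → Expo → Prop) (S : Finset Expo), IsCellFamily u v R S → (∀ l ∈ S, l 0 + l 1 < N) →
      ∃ R' : Expo → Expo → Prop,
        IsCellFamily (Fin.append u (Fin.append z z)) (Fin.append v (fun _ : Fin (g + g) => (0 : MvPolynomial (Fin 2) ℂ))) R' S) := by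
  classical
  have hu0 : ∀ j, coeff 0 (u j) = 0 := fun j => (hu j).1
  have hv0 : ∀ j, coeff 0 (v j) = 0 := fun j => (hv j).1
  set s : Expo := ∑ f ∈ tailSupport u v, f with hs_def
  have hs0 : s ≠ 0 := tailSum_ne_zero hu0 hv0 hT
  have hσ0 : N • s ≠ 0 := nsmul_ne_zero' hs0 (by omega)
  have hzi : ∀ i : Fin g, z i = monomial ((2 * 5 ^ (i : ℕ)) • (N • s)) (1 : ℂ) + monomial ((2 * (2 * 5 ^ (i : ℕ))) • (N • s)) 1 :=
    fun i => by rw [hz]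
  have hzz : ∀ x : Fin (g + g), ∃ i : Fin g, Fin.append z z x = z i := by
    intro x
    induction x using Fin.addCases with
    | left i => exact ⟨i, Fin.append_left z z i⟩
    | right i => exact ⟨i, Fin.append_right z z i⟩
  -- support points of the gadgets: on the ray of `N • s`, multiples `n • s` with `n ≥ 2`
  have hwray : ∀ x : Fin (g + g), ∀ e ∈ (Fin.append z z x).support, ∃ n : ℕ, e = n • (N • s) := by
    intro x e he
    obtain ⟨i, hi⟩ := hzz x
    rw [hi, hzi] at he
    rcases mem_support_gadget he with h | h
    · exact ⟨_, h⟩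
    · exact ⟨_, h⟩
  have hwsupp : ∀ x : Fin (g + g), ∀ e ∈ (Fin.append z z x).support, ∃ n, 2 ≤ n ∧ e = n • s := by
    intro x e he
    obtain ⟨i, hi⟩ := hzz x
    rw [hi, hzi] at he
    have h2 := two_le_scale i
    rcases mem_support_gadget he with h | h
    · exact ⟨2 * 5 ^ (i : ℕ) * N, by nlinarith, by rw [h, smul_smul]⟩
    · exact ⟨2 * (2 * 5 ^ (i : ℕ)) * N, by nlinarith, by rw [h, smul_smul]⟩
  have hwnorm : ∀ x : Fin (g + g), coeff 0 (Fin.append z z x) = 0 ∧ (Fin.append z z x).support.card ≤ t := by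
    intro x
    obtain ⟨i, hi⟩ := hzz x
    rw [hi, hzi]
    exact ⟨coeff_zero_gadget hσ0 (scale_ne_zero i), (card_support_gadget (N • s) _).trans ht⟩
  have h0norm : ∀ x : Fin (g + g), coeff 0 ((fun _ : Fin (g + g) => (0 : MvPolynomial (Fin 2) ℂ)) x) = 0 ∧
      ((fun _ : Fin (g + g) => (0 : MvPolynomial (Fin 2) ℂ)) x).support.card ≤ t := by
    intro x
    simp
  have hwtail : ∀ e ∈ tailSupport (Fin.append z z) (fun _ : Fin (g + g) => (0 : MvPolynomial (Fin 2) ℂ)),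
      ∃ x : Fin (g + g), e ∈ (Fin.append z z x).support := by
    intro e he
    unfold tailSupport at he
    simpa using he
  -- hypotheses of `isCellFamily_append_oneSided`
  have hneg : ∀ ξ, ValidWeight u v ξ → ValidWeight (Fin.append z z) (fun _ : Fin (g + g) => (0 : MvPolynomial (Fin 2) ℂ)) ξ := by
    intro ξ hval
    refine ⟨fun x e he => ?_, fun x e he => by simp at he⟩
    obtain ⟨n, hn, rfl⟩ := hwsupp x e he
    rw [wt_nsmul]
    have hsneg := wt_tailSum_neg hval hT
    have hn' : (1 : ℝ) ≤ n := by exact_mod_cast (show 1 ≤ n by omega)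
    nlinarith
  have hdeep : ∀ ξ, ValidWeight u v ξ → ∀ e ∈ tailSupport u v,
      ∀ e' ∈ tailSupport (Fin.append z z) (fun _ : Fin (g + g) => (0 : MvPolynomial (Fin 2) ℂ)), wt ξ e' < wt ξ e := by
    intro ξ hval e he e' he'
    obtain ⟨x, hx⟩ := hwtail e' he'
    obtain ⟨n, hn, rfl⟩ := hwsupp x e' hx
    exact wt_nsmul_tailSum_lt hval he hn
  have hspos : 0 < s 0 + s 1 := by
    obtain ⟨c, hc⟩ := Finsupp.ne_iff.mp hs0
    simp only [Finsupp.coe_zero, Pi.zero_apply] at hc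
    rcases (Fin.exists_fin_two (p := fun c => s c ≠ 0)).mp ⟨c, hc⟩ with h | h
    · omega
    · omega
  have hQ : ∀ ξ, ValidWeight u v ξ → ∀ e ∈ tailSupport (Fin.append z z) (fun _ : Fin (g + g) => (0 : MvPolynomial (Fin 2) ℂ)),
      ∀ e' ∈ tailSupport (Fin.append z z) (fun _ : Fin (g + g) => (0 : MvPolynomial (Fin 2) ℂ)),
      ((e' 0 + e' 1 ≤ e 0 + e 1) ↔ wt ξ e ≤ wt ξ e') := by
    intro ξ hval e he e' he'
    obtain ⟨x, hx⟩ := hwtail e he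
    obtain ⟨n, -, rfl⟩ := hwsupp x e hx
    obtain ⟨x', hx'⟩ := hwtail e' he'
    obtain ⟨n', -, rfl⟩ := hwsupp x' e' hx'
    rw [wt_nsmul_tailSum_le_iff hval hT]
    simp only [Finsupp.smul_apply, smul_eq_mul, ← mul_add]
    constructor
    · exact fun h => Nat.le_of_mul_le_mul_right h hspos
    · exact fun h => Nat.mul_le_mul_right _ h
  -- the log-support on `S`
  have hlog : ∀ (S : Finset Expo), (∀ l ∈ S, l 0 + l 1 < N) → ∀ ξ, ValidWeight u v ξ → ∀ l ∈ S,
      IsStrictTop ξ (logSupport u v) l →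
      IsStrictTop ξ (logSupport (Fin.append u (Fin.append z z))
        (Fin.append v (fun _ : Fin (g + g) => (0 : MvPolynomial (Fin 2) ℂ)))) l := by
    intro S hSN ξ hval l hl htop
    -- log-coefficients of the gadgets vanish off the ray `ℕ (N • s)`
    have hoff : ∀ μ : Expo, (∀ n : ℕ, μ ≠ n • (N • s)) →
        logDiff (Fin.append u (Fin.append z z)) (Fin.append v (fun _ : Fin (g + g) => (0 : MvPolynomial (Fin 2) ℂ))) μ =
          logDiff u v μ := by
      intro μ hμ
      rw [logDiff_append_oneSided, Finset.sum_eq_zero (fun x _ => logCoeff_eq_zero_off_ray _ _ (hwray x) μ hμ), add_zero]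
    -- weight of a ray point `n • (N • s)`, `n ≥ 1`, is below `wt ξ l`
    have hsneg := wt_tailSum_neg hval hT
    have hlow : ∀ n : ℕ, 1 ≤ n → wt ξ (n • (N • s)) < wt ξ l := by
      intro n hn
      have hb := norm_mul_wt_le_of_mem_logSupport hval htop.1
      rw [← hs_def] at hb
      rw [wt_nsmul, wt_nsmul]
      have hlN : ((l 0 + l 1 : ℕ) : ℝ) + 1 ≤ (N : ℝ) := by exact_mod_cast hSN l hl
      have hn' : (1 : ℝ) ≤ n := by exact_mod_cast hn
      have hNpos : (0 : ℝ) < N := by exact_mod_cast hN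
      have h1 : (N : ℝ) * wt ξ s ≤ (((l 0 + l 1 : ℕ) : ℝ) + 1) * wt ξ s := mul_le_mul_of_nonpos_right hlN hsneg.le
      have h2 : (n : ℝ) * ((N : ℝ) * wt ξ s) ≤ 1 * ((N : ℝ) * wt ξ s) :=
        mul_le_mul_of_nonpos_right hn' (mul_nonpos_of_nonneg_of_nonpos hNpos.le hsneg.le)
      linarith
    -- `l` is off the ray
    have hlray : ∀ n : ℕ, l ≠ n • (N • s) := by
      intro n hln
      rcases Nat.eq_zero_or_pos n with rfl | hn
      · rw [zero_nsmul] at hln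
        exact zero_notMem_logSupport u v (hln ▸ htop.1)
      · have := hlow n hn
        rw [← hln] at this
        exact lt_irrefl _ this
    refine ⟨?_, fun μ hμ hne => ?_⟩
    · show logDiff _ _ l ≠ 0
      rw [hoff l hlray]
      exact htop.1
    · by_cases hray : ∃ n : ℕ, μ = n • (N • s)
      · obtain ⟨n, rfl⟩ := hray
        rcases Nat.eq_zero_or_pos n with rfl | hn
        · rw [zero_nsmul] at hμ
          exact absurd hμ (zero_notMem_logSupport _ _)
        · exact hlow n hn
      · push Not at hray
        have hμ' : μ ∈ logSupport u v := by
          have h' : logDiff _ _ μ ≠ 0 := hμ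
          rw [hoff μ hray] at h'
          exact h'
        exact htop.2 μ hμ' hne
  refine ⟨norm_append u _ hu hwnorm, norm_append v _ hv h0norm, fun ξ => ?_, fun e he => ?_,
    fun R S hS hSN => ⟨_, isCellFamily_append_oneSided u v _ _ _ S hneg hdeep hQ (hlog S hSN) R hS⟩⟩
  · rw [validWeight_append_iff]
    exact ⟨fun h => h.1, fun h => ⟨h, hneg ξ h⟩⟩
  · rw [tailSupport_append, Finset.mem_union] at he
    rcases he with he | he
    · exact Or.inl he
    · obtain ⟨x, hx⟩ := hwtail e he
      exact Or.inr (hwsupp x e hx)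

/-- **Letters of the one-sided padded family** at the gadget positions (the shape consumed by `FullPaddingThresholds`). [folklore] -/
theorem oneSided_letters (u v : Fin m → MvPolynomial (Fin 2) ℂ) (hs0 : ∑ f ∈ tailSupport u v, f ≠ 0) (N : ℕ) (hN : 1 ≤ N)
    (z : Fin g → MvPolynomial (Fin 2) ℂ)
    (hz : z = fun i : Fin g => monomial ((2 * 5 ^ (i : ℕ)) • (N • ∑ f ∈ tailSupport u v, f)) (1 : ℂ) +
      monomial ((2 * (2 * 5 ^ (i : ℕ))) • (N • ∑ f ∈ tailSupport u v, f)) 1) (i : Fin g) :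
    ((2 * 5 ^ (i : ℕ)) • (N • ∑ f ∈ tailSupport u v, f) ∈
        (Fin.append u (Fin.append z z) (Fin.natAdd m (Fin.castAdd g i))).support ∪
          (Fin.append v (fun _ : Fin (g + g) => (0 : MvPolynomial (Fin 2) ℂ)) (Fin.natAdd m (Fin.castAdd g i))).support ∧
      (2 * (2 * 5 ^ (i : ℕ))) • (N • ∑ f ∈ tailSupport u v, f) ∈
        (Fin.append u (Fin.append z z) (Fin.natAdd m (Fin.castAdd g i))).support ∪
          (Fin.append v (fun _ : Fin (g + g) => (0 : MvPolynomial (Fin 2) ℂ)) (Fin.natAdd m (Fin.castAdd g i))).support) ∧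
    ((2 * 5 ^ (i : ℕ)) • (N • ∑ f ∈ tailSupport u v, f) ∈
        (Fin.append u (Fin.append z z) (Fin.natAdd m (Fin.natAdd g i))).support ∪
          (Fin.append v (fun _ : Fin (g + g) => (0 : MvPolynomial (Fin 2) ℂ)) (Fin.natAdd m (Fin.natAdd g i))).support ∧
      (2 * (2 * 5 ^ (i : ℕ))) • (N • ∑ f ∈ tailSupport u v, f) ∈
        (Fin.append u (Fin.append z z) (Fin.natAdd m (Fin.natAdd g i))).support ∪
          (Fin.append v (fun _ : Fin (g + g) => (0 : MvPolynomial (Fin 2) ℂ)) (Fin.natAdd m (Fin.natAdd g i))).support) := by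
  have hσ0 : N • ∑ f ∈ tailSupport u v, f ≠ 0 := nsmul_ne_zero' hs0 (by omega)
  have hzi : z i = monomial ((2 * 5 ^ (i : ℕ)) • (N • ∑ f ∈ tailSupport u v, f)) (1 : ℂ) +
      monomial ((2 * (2 * 5 ^ (i : ℕ))) • (N • ∑ f ∈ tailSupport u v, f)) 1 := by rw [hz]
  have h1 : Fin.append u (Fin.append z z) (Fin.natAdd m (Fin.castAdd g i)) = z i := by
    rw [Fin.append_right, Fin.append_left]
  have h2 : Fin.append u (Fin.append z z) (Fin.natAdd m (Fin.natAdd g i)) = z i := by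
    rw [Fin.append_right, Fin.append_right]
  have hl := nsmul_mem_support_gadget hσ0 (scale_ne_zero (i : ℕ))
  rw [h1, h2, hzi]
  exact ⟨⟨Finset.mem_union_left _ hl.1, Finset.mem_union_left _ hl.2⟩, ⟨Finset.mem_union_left _ hl.1, Finset.mem_union_left _ hl.2⟩⟩

end Summit.ValiantsHypothesis.Theorems.TwoProducts.Negative.OneSidedPadding
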